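import Summits.AtomisticToContinuum.HydrodynamicLimit.Theorems.OneFlightGossipEngineCollisionActivityTailsEndpointTails
import Summits.AtomisticToContinuum.HydrodynamicLimit.Theorems.OneFlightGossipEngineEnergyCurrentTailsLevelCensusEventMeasurable
import Literature.Analysis.FluidPDE.EmpiricalCollisionMeasureMeasurableLabels
import HarnessLib

/-!
# A.e.-measurability of the tagged weighted window count (stub `stub_weightedCountAEMeasurable`)

Crux `Summit.AtomisticToContinuum.HydrodynamicLimit.Theses.TwoClocks.TransferActivityTails`
(stmt-AtomisticToContinuum-16624), line `IdeatorOneSketch` (idea `tagged-count-chernoff`), registered stub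
`stub_weightedCountAEMeasurable : WeightedCountAEMeasurable` (the defs `Rec`, `hitWeight`, `weightedCount`,
`WeightedCountAEMeasurable` re-declared verbatim from the line skeleton).

For `0 < σ < 1/2` the tagged sphere's weighted window count
`W_i(s) : z ↦ Σ_{collisions of i in (s, s + w]} 2 (1 + ‖v_i⁻‖² + ‖v_j⁻‖²) · min 1 ‖v_i⁺ − v_i⁻‖`
along the hard-sphere flow `Φ` is a.e.-measurable in the datum `z` under the local Gibbs law.  On the collisions
of a good orbit (ordered contact pairs, `0 < ε = hsDiameter σ N`) the elastic law read off the collision mark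
`(t, x, ω, v⁻, v_*⁻)` gives the jump `v⁺ − v⁻ = −⟪v⁻ − v_*⁻, ω⟫ ω`
(`EnergyCurrentTailsLevelCensus.ofConfig_postVel_eq_of_mem_contactSet`), so by `collisionSum_congr` the count
agrees on the good set with the label-dependent collision sum of the CONTINUOUS mark functional
`F k l m = 𝟙{k = i} · 2 (1 + ‖m_v‖² + ‖m_{v*}‖²) · min 1 ‖⟪m_v − m_{v*}, m_ω⟫ m_ω‖`, and the label-aware engine
`HardSphereFlow.aemeasurable_of_eqOn_collisionSum_labels_torus` (`ε < 1/2`; the local Gibbs law is carried by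
the good set, `ae_mem_good_localGibbsLaw`) concludes.  Adapted from the `hmeas` block of
`ClampedCurrentsDockTransferTails.stub_transferActivityTails`.

References: I. Gallagher, L. Saint-Raymond, B. Texier, *From Newton to Boltzmann* (2013) §1.1, §4.1 (elastic law,
collision marks of the hard-sphere flow); C. Cercignani, R. Illner, M. Pulvirenti (1994) §4.2.
-/

noncomputable section

open MeasureTheory Set Filter Topology
open scoped ENNReal InnerProductSpace BigOperators

namespace Summit.AtomisticToContinuum.HydrodynamicLimit.Theorems.TransferActivityTailsWeightedCountAEMeasurable

open Literature.MathematicalPhysics.KineticTheory Literature.Analysis.FluidPDE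
open Summit.AtomisticToContinuum.HydrodynamicLimit.Theorems.CollisionActivityTailsEndpointTails
  (Flow Cfg window tailFn tailFn_of_lt tailFn_of_le measurable_tailFn ae_mem_good_localGibbsLaw)
open Summit.AtomisticToContinuum.HydrodynamicLimit.Theorems.EnergyCurrentTailsLevelCensus
  (ofConfig_postVel_eq_of_mem_contactSet)

/-! ## The statement (verbatim from the line skeleton) -/

/-- Collision records of `N + 1` spheres on `𝕋³` (registered stub signature of line IdeatorOneSketch, crux
TransferActivityTails (stmt-AtomisticToContinuum-16624) — route-internal, not a cited fact). -/
abbrev Rec (N : ℕ) : Type := HardSphereCollisionRecord (Fin 3) T3 (N + 1)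

/-- The ENERGY-MARKED, IMPULSE-TRUNCATED hit weight of particle `i`:
`2 (1 + ‖v_i⁻‖² + ‖v_j⁻‖²) · min 1 ‖v_i⁺ − v_i⁻‖` on records whose first label is `i`, else `0` (registered stub
signature of line IdeatorOneSketch, crux TransferActivityTails (stmt-AtomisticToContinuum-16624) — route-internal,
not a cited fact). -/
def hitWeight {N : ℕ} (i : Fin (N + 1)) (c : Rec N) : ℝ :=
  if c.fst = i then 2 * (1 + ‖c.preVel.1‖ ^ 2 + ‖c.preVel.2‖ ^ 2) * min 1 ‖c.postVel.1 - c.preVel.1‖ else 0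

/-- The tagged sphere's weighted window count `W_i(s) = Σ_{collisions of i in (s, s + w]} hitWeight` (registered stub
signature of line IdeatorOneSketch, crux TransferActivityTails (stmt-AtomisticToContinuum-16624) — route-internal,
not a cited fact). -/
def weightedCount {σ : ℝ} {N : ℕ} (Φ : Flow σ N) (τ s : ℝ) (i : Fin (N + 1)) (z : Cfg N) : ℝ :=
  Φ.collisionSum (Set.Ioc s (s + window τ N)) (hitWeight i) z

/-- Stub 3 of the line: for `0 < σ < 1/2` the tagged weighted window count is a.e.-measurable under the local Gibbs
law (registered stub signature of line IdeatorOneSketch, crux TransferActivityTails (stmt-AtomisticToContinuum-16624)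
— route-internal, not a cited fact). -/
def WeightedCountAEMeasurable : Prop :=
  ∀ (σ : ℝ), 0 < σ → σ < 2⁻¹ → ∀ (a₀ θ₀ : T3 → ℝ) (u₀ : T3 → V3) (N : ℕ) (Φ : Flow σ N) (τ s : ℝ)
    (i : Fin (N + 1)), AEMeasurable (weightedCount Φ τ s i) (localGibbsLaw σ a₀ u₀ θ₀ N Φ)

/-! ## The proof -/

/-- **Stub 3 (registered): a.e.-measurability of the weighted count under the local Gibbs law.**  On the
collisions of a good orbit the hit weight is the continuous mark functional
`𝟙{k = i} · 2 (1 + ‖v⁻‖² + ‖v_*⁻‖²) · min 1 ‖⟪v⁻ − v_*⁻, ω⟫ ω‖` of the ordered labels and the mark (elastic law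
`v⁺ = v⁻ − ⟪v⁻ − v_*⁻, ω⟫ ω` at contact), so the label-aware engine
`HardSphereFlow.aemeasurable_of_eqOn_collisionSum_labels_torus` applies (`hsDiameter σ N ≤ σ < 1/2`; the local
Gibbs law gives full mass to the good set). -/
theorem stub_weightedCountAEMeasurable : WeightedCountAEMeasurable := by
  intro σ hσ hσ2 a₀ θ₀ u₀ N Φ τ s i
  have hε : hsDiameter σ N < 2⁻¹ := (hsDiameter_le hσ.le N).trans_lt hσ2
  have hε0 : 0 < hsDiameter σ N := hsDiameter_pos hσ N
  -- the mark functional is continuous at fixed labels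
  have hFc : ∀ k l : Fin (N + 1), Continuous fun m : ℝ × T3 × V3 × V3 × V3 =>
      if k = i then 2 * (1 + ‖m.2.2.2.1‖ ^ 2 + ‖m.2.2.2.2‖ ^ 2) *
        min 1 ‖⟪m.2.2.2.1 - m.2.2.2.2, m.2.2.1⟫_ℝ • m.2.2.1‖ else 0 := by
    intro k l
    by_cases hk : k = i
    · simp only [hk, if_true]
      fun_prop
    · simp only [hk, if_false]
      exact continuous_const
  -- adapted from `ClampedCurrentsDockTransferTails.stub_transferActivityTails` (the `hmeas` block)
  refine Φ.aemeasurable_of_eqOn_collisionSum_labels_torus hε hFc s (s + window τ N) (fun z _ => ?_)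
    (ae_mem_good_localGibbsLaw σ a₀ θ₀ u₀ N Φ)
  rw [weightedCount, HardSphereFlow.collisionSum_eq, HardSphereFlow.collisionSum_eq]
  refine collisionSum_congr fun t _ p hp => ?_
  obtain ⟨-, hc⟩ := mem_contactPairs.1 hp
  by_cases hpi : p.1 = i
  · have hpost := congrArg Prod.fst (ofConfig_postVel_eq_of_mem_contactSet hε0 t hc)
    simp only [hitWeight, HardSphereCollisionRecord.ofConfig_fst, HardSphereCollisionRecord.mark_def]
    rw [if_pos hpi, if_pos hpi, hpost, sub_sub_cancel_left, norm_neg]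
  · simp only [hitWeight, HardSphereCollisionRecord.ofConfig_fst]
    rw [if_neg hpi, if_neg hpi]

end Summit.AtomisticToContinuum.HydrodynamicLimit.Theorems.TransferActivityTailsWeightedCountAEMeasurable

end
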